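import Mathlib.GroupTheory.Complement
import Summits.MatrixMultiplication.OmegaCensus.CentreIndexFourGroups

/-!
# ω-census, family (b3): conjecture C9 (c), class `[G:Z(G)] = 4` — the LOWER bound `α(G;|G|,3,3) ≥ (3/2)|G|` (kernel, every such group)

HONEST FRAMING (pub-omega census; verbatim): lottery ticket; floor = certified bounds/negative ranges.
Census BOOKKEEPING (conjecture C9 (c) of the cell — the value `r = 3/2` of the class `[G:Z(G)] = 4`; pub-omega stpp-1
gen 17): a UNIFORM box witness.  If `z = y₀ x₀⁻¹ y₀⁻¹ x₀` is an involution (`z ≠ 1`, `z² = 1`) — in particular for any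
non-commuting pair of a group whose centre has index `4` (`SmallComm`: all commutators are `1` or the central involution `z`) —
then the box `G × {1, x₀, y₀} × {1, x₀, y₀}` carries an independent cell set of `(3/2)|G|` cells
(`exists_indep_three_halves`): with `B` a right transversal of `⟨z⟩` (so `B ∩ zB = ∅`, `2|B| = |G|`), take the cells
`(a, 1, 1)` for `a ∉ x₀B`, `(b, 1, x₀)` for `b ∈ B`, `(c, 1, y₀)` for `c ∈ y₀⁻¹x₀B`; the six mixed word equations reduce to
`a ∈ x₀B` or to `b' = z b` inside `B`.  Hence (`exists_indep_three_halves_of_index_center_four`) every finite group with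
`[G:Z(G)] = 4` has box ratio `≥ 3/2`; with the kernel law R311 (`CentreIndexFour.two_mul_volume_le_of_index_center`,
`2|S||T||U| ≤ 3|G|`; box form `SmallComm.two_mul_card_indep_le`) the ratio of the class is EXACTLY `3/2`.  The engine's witnesses
for `D₈` and `Q₈` (α = 12) have exactly this shape (one `y`, `W = {1, r, s}`).  Nothing here is progress on `ω`.
-/

namespace Summit.MatrixMultiplication.OmegaCensus.CentreIndexFour

open Finset

variable {G : Type*} [Group G]

/-- Tagging an element as the cell `(x, 1, w)`. [folklore] -/
def tagCell (w : G) : G ↪ G × G × G := ⟨fun x => (x, 1, w), fun a b e => by simpa using congrArg Prod.fst e⟩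

/-- Membership in a tagged image. [folklore] -/
theorem mem_map_tagCell {S : Finset G} {w : G} {P : G × G × G} :
    P ∈ S.map (tagCell w) ↔ P.1 ∈ S ∧ P.2.1 = 1 ∧ P.2.2 = w := by
  constructor
  · rintro h
    obtain ⟨x, hx, rfl⟩ := Finset.mem_map.1 h
    exact ⟨hx, rfl, rfl⟩
  · rintro ⟨h1, h2, h3⟩
    exact Finset.mem_map.2 ⟨P.1, h1, by rcases P with ⟨x, y, w'⟩; simp only at h2 h3; subst h2; subst h3; rfl⟩

/-- **The uniform `3/2` witness.** If `z = y₀ x₀⁻¹ y₀⁻¹ x₀` is an involution then some `3 × 3` box carries an independent cell set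
`J` with `2|J| = 3|G|`. [folklore] -/
theorem exists_indep_three_halves [Fintype G] [DecidableEq G] {x₀ y₀ z : G} (hz : y₀ * x₀⁻¹ * y₀⁻¹ * x₀ = z)
    (hz1 : z ≠ 1) (hzz : z * z = 1) :
    ∃ (Y W : Finset G) (J : Finset (G × G × G)), #Y = 3 ∧ #W = 3 ∧ J ⊆ univ ×ˢ (Y ×ˢ W) ∧
      (∀ P ∈ J, ∀ P' ∈ J, P ≠ P' → E P P' ≠ 1) ∧ 2 * #J = 3 * Fintype.card G := by
  classical
  -- `x₀, y₀, 1` are pairwise distinct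
  have hx1 : x₀ ≠ 1 := by rintro rfl; apply hz1; rw [← hz]; group
  have hy1 : y₀ ≠ 1 := by rintro rfl; apply hz1; rw [← hz]; group
  have hxy : x₀ ≠ y₀ := by rintro rfl; apply hz1; rw [← hz]; group
  -- a right transversal `B` of `⟨z⟩`: `G = B ⊔ zB`
  set H : Subgroup G := Subgroup.zpowers z with hH
  have hzH : z ∈ H := Subgroup.mem_zpowers z
  have hcardH : Nat.card H = 2 := by
    rw [hH, Nat.card_zpowers]; exact orderOf_eq_prime (by rw [pow_two]; exact hzz) hz1
  obtain ⟨R, hR, -⟩ := H.exists_isComplement_right 1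
  have hRfin : R.Finite := Set.toFinite R
  set B : Finset G := hRfin.toFinset with hBdef
  have memB : ∀ r, r ∈ B ↔ r ∈ R := fun r => Set.Finite.mem_toFinset hRfin
  have cardB : 2 * #B = Fintype.card G := by
    have h1 : #B = H.index := by rw [hBdef, ← hR.ncard_right, Set.ncard_eq_toFinset_card R hRfin]
    rw [h1, ← hcardH, ← Nat.card_eq_fintype_card]; exact H.card_mul_index
  have noZ : ∀ b ∈ B, ∀ b' ∈ B, z * b ≠ b' := by
    intro b hb b' hb' e
    have := @hR.1 (⟨z, hzH⟩, ⟨b, (memB b).1 hb⟩) (⟨1, H.one_mem⟩, ⟨b', (memB b').1 hb'⟩) (by simpa using e)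
    simp only [Prod.mk.injEq, Subtype.mk.injEq] at this
    exact hz1 this.1
  -- the three parts
  set XB : Finset G := B.image (x₀ * ·) with hXB
  set A : Finset G := univ \ XB with hA
  set C : Finset G := B.image (y₀⁻¹ * x₀ * ·) with hC
  have cardXB : #XB = #B := card_image_of_injective _ (mul_right_injective x₀)
  have cardA : #A + #B = Fintype.card G := by
    have hle : #XB ≤ Fintype.card G := card_le_univ XB
    rw [hA, card_sdiff_of_subset (subset_univ _), card_univ, cardXB]; rw [cardXB] at hle; omega
  have cardC : #C = #B := card_image_of_injective _ (mul_right_injective (y₀⁻¹ * x₀))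
  have memA : ∀ a, a ∈ A ↔ ∀ b ∈ B, a ≠ x₀ * b := by
    intro a; simp only [hA, hXB, mem_sdiff, mem_univ, true_and, mem_image, not_exists, not_and]
    exact ⟨fun h b hb e => h b hb e.symm, fun h b hb e => h b hb e.symm⟩
  have memC : ∀ c, c ∈ C ↔ ∃ b ∈ B, y₀⁻¹ * x₀ * b = c := fun c => by simp only [hC, mem_image]
  -- the cell set
  have d12 : Disjoint (A.map (tagCell 1)) (B.map (tagCell x₀)) := by
    rw [disjoint_left]; intro P h1 h2
    exact hx1 (((mem_map_tagCell.1 h2).2.2).symm.trans (mem_map_tagCell.1 h1).2.2)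
  set J12 := (A.map (tagCell 1)).disjUnion (B.map (tagCell x₀)) d12 with hJ12
  have d3 : Disjoint J12 (C.map (tagCell y₀)) := by
    rw [disjoint_left]; intro P h12 h3
    have e3 := (mem_map_tagCell.1 h3).2.2
    rcases mem_disjUnion.1 h12 with h1 | h2
    · exact hy1 (e3.symm.trans (mem_map_tagCell.1 h1).2.2)
    · exact hxy ((mem_map_tagCell.1 h2).2.2.symm.trans e3)
  set J := J12.disjUnion (C.map (tagCell y₀)) d3 with hJ
  refine ⟨{1, x₀, y₀}, {1, x₀, y₀}, J, ?_, ?_, ?_, ?_, ?_⟩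
  · rw [card_insert_of_notMem (by simp [hx1.symm, hy1.symm]), card_insert_of_notMem (by simpa using hxy), card_singleton]
  · rw [card_insert_of_notMem (by simp [hx1.symm, hy1.symm]), card_insert_of_notMem (by simpa using hxy), card_singleton]
  · intro P hP
    simp only [mem_product, mem_univ, true_and, mem_insert, mem_singleton]
    rcases mem_disjUnion.1 hP with h12 | h3
    · rcases mem_disjUnion.1 h12 with h1 | h2
      · obtain ⟨-, e2, e3⟩ := mem_map_tagCell.1 h1; exact ⟨Or.inl e2, Or.inl e3⟩
      · obtain ⟨-, e2, e3⟩ := mem_map_tagCell.1 h2; exact ⟨Or.inl e2, Or.inr (Or.inl e3)⟩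
    · obtain ⟨-, e2, e3⟩ := mem_map_tagCell.1 h3; exact ⟨Or.inl e2, Or.inr (Or.inr e3)⟩
  · -- independence: nine cases on the third coordinates
    rintro ⟨x, y, w⟩ hP ⟨x', y', w'⟩ hP' hne hw
    have cases : ∀ {P : G × G × G}, P ∈ J → (P.1 ∈ A ∧ P.2.1 = 1 ∧ P.2.2 = 1) ∨ (P.1 ∈ B ∧ P.2.1 = 1 ∧ P.2.2 = x₀) ∨
        (P.1 ∈ C ∧ P.2.1 = 1 ∧ P.2.2 = y₀) := by
      intro P hP
      rcases mem_disjUnion.1 hP with h12 | h3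
      · rcases mem_disjUnion.1 h12 with h1 | h2
        · exact Or.inl (mem_map_tagCell.1 h1)
        · exact Or.inr (Or.inl (mem_map_tagCell.1 h2))
      · exact Or.inr (Or.inr (mem_map_tagCell.1 h3))
    simp only [E] at hw
    rcases cases hP with ⟨hx, hy, hw1⟩ | ⟨hx, hy, hw1⟩ | ⟨hx, hy, hw1⟩ <;>
      rcases cases hP' with ⟨hx', hy', hw1'⟩ | ⟨hx', hy', hw1'⟩ | ⟨hx', hy', hw1'⟩ <;>
      simp only at hx hy hw1 hx' hy' hw1' <;> rw [hy, hy', hw1, hw1'] at hw hne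
    · -- (A, A)
      exact hne (by rw [show x = x' from by calc x = x * x'⁻¹ * (1 * 1⁻¹) * (1 * 1⁻¹) * x' := by group
                                               _ = x' := by rw [hw, one_mul]])
    · -- (A, B): x = x₀ x'
      exact (memA x).1 hx x' hx' (by calc x = x * x'⁻¹ * (1 * 1⁻¹) * (1 * x₀⁻¹) * (x₀ * x') := by group
                                       _ = x₀ * x' := by rw [hw, one_mul])
    · -- (A, C): x = y₀ x' = x₀ b
      obtain ⟨b, hb, rfl⟩ := (memC x').1 hx'
      exact (memA x).1 hx b hb (by calc x = x * (y₀⁻¹ * x₀ * b)⁻¹ * (1 * 1⁻¹) * (1 * y₀⁻¹) * (x₀ * b) := by group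
                                      _ = x₀ * b := by rw [hw, one_mul])
    · -- (B, A): x' = x₀ x
      exact (memA x').1 hx' x hx (by calc x' = x₀ * (x * x'⁻¹ * (1 * 1⁻¹) * (x₀ * 1⁻¹))⁻¹ * x := by group
                                       _ = x₀ * x := by rw [hw, inv_one, mul_one])
    · -- (B, B)
      exact hne (by rw [show x = x' from by calc x = x * x'⁻¹ * (1 * 1⁻¹) * (x₀ * x₀⁻¹) * x' := by group
                                               _ = x' := by rw [hw, one_mul]])
    · -- (B, C): z b' = x
      obtain ⟨b', hb', rfl⟩ := (memC x').1 hx'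
      refine noZ b' hb' x hx ?_
      calc z * b' = y₀ * x₀⁻¹ * y₀⁻¹ * x₀ * b' := by rw [hz]
        _ = (x * (y₀⁻¹ * x₀ * b')⁻¹ * (1 * 1⁻¹) * (x₀ * y₀⁻¹))⁻¹ * x := by group
        _ = x := by rw [hw, inv_one, one_mul]
    · -- (C, A): x' = y₀ x = x₀ b
      obtain ⟨b, hb, rfl⟩ := (memC x).1 hx
      exact (memA x').1 hx' b hb (by
        calc x' = y₀ * (y₀⁻¹ * x₀ * b * x'⁻¹ * (1 * 1⁻¹) * (y₀ * 1⁻¹))⁻¹ * y₀⁻¹ * (x₀ * b) := by group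
          _ = x₀ * b := by rw [hw]; group)
    · -- (C, B): z b = x'
      obtain ⟨b, hb, rfl⟩ := (memC x).1 hx
      refine noZ b hb x' hx' ?_
      calc z * b = y₀ * x₀⁻¹ * (1 : G)⁻¹ * y₀⁻¹ * x₀ * b := by rw [← hz]; group
        _ = y₀ * x₀⁻¹ * (y₀⁻¹ * x₀ * b * x'⁻¹ * (1 * 1⁻¹) * (y₀ * x₀⁻¹))⁻¹ * y₀⁻¹ * x₀ * b := by rw [hw]
        _ = x' := by group
    · -- (C, C)
      exact hne (by rw [show x = x' from by calc x = x * x'⁻¹ * (1 * 1⁻¹) * (y₀ * y₀⁻¹) * x' := by group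
                                               _ = x' := by rw [hw, one_mul]])
  · rw [hJ, card_disjUnion, hJ12, card_disjUnion, card_map, card_map, card_map, cardC]
    omega

/-- **C9 (c), class `[G:Z(G)] = 4`, lower side (kernel).** Every finite group whose centre has index `4` has a `3 × 3` box with
an independent cell set `J`, `2|J| = 3|G|` — so with R311 (`2|I| ≤ 3|G|`) the box ratio of the class is exactly `3/2`. [folklore] -/
theorem exists_indep_three_halves_of_index_center_four [Fintype G] [DecidableEq G] (h4 : (Subgroup.center G).index = 4) :
    ∃ (Y W : Finset G) (J : Finset (G × G × G)), #Y = 3 ∧ #W = 3 ∧ J ⊆ univ ×ˢ (Y ×ˢ W) ∧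
      (∀ P ∈ J, ∀ P' ∈ J, P ≠ P' → E P P' ≠ 1) ∧ 2 * #J = 3 * Fintype.card G := by
  obtain ⟨z, hz⟩ := exists_smallComm h4
  have hne : ∃ a b : G, a * b ≠ b * a := by
    by_contra! hall
    have htop : Subgroup.center G = ⊤ := by
      rw [Subgroup.eq_top_iff']; intro x; rw [Subgroup.mem_center_iff]; intro g; exact hall g x
    rw [htop, Subgroup.index_top] at h4
    exact absurd h4 (by norm_num)
  obtain ⟨a, b, hab⟩ := hne
  have e : a * b = b * a * z := (hz.comm_or a b).resolve_left hab
  -- with `y₀ = a`, `x₀ = b⁻¹`: `y₀ x₀⁻¹ y₀⁻¹ x₀ = a b a⁻¹ b⁻¹ = z`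
  refine exists_indep_three_halves (x₀ := b⁻¹) (y₀ := a) (z := z) ?_ hz.ne_one hz.sq
  calc a * b⁻¹⁻¹ * a⁻¹ * b⁻¹ = a * b * a⁻¹ * b⁻¹ := by rw [inv_inv]
    _ = b * a * z * a⁻¹ * b⁻¹ := by rw [e]
    _ = b * a * (z * a⁻¹) * b⁻¹ := by group
    _ = b * a * (a⁻¹ * z) * b⁻¹ := by rw [hz.central a⁻¹]
    _ = b * (z * b⁻¹) := by group
    _ = b * (b⁻¹ * z) := by rw [hz.central b⁻¹]
    _ = z := by group

end Summit.MatrixMultiplication.OmegaCensus.CentreIndexFour
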